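import Mathlib.Analysis.Calculus.MeanValue
import Mathlib.MeasureTheory.Integral.IntervalIntegral.FundThmCalculus
import Mathlib.MeasureTheory.Integral.DominatedConvergence
import Mathlib.Analysis.SpecialFunctions.ExpDeriv
import HarnessLib

/-!
# K1L_D `LagrangianRenormalisationStepDesign` (stmt-AnomalousDissipation-27980), `stub_D1_V0` (V0 = clause (ii) of
# `WCrossing.D1ExactFamily`), brick T4c-4: FORCED GRÖNWALL FROM THE RIGHT with a CONTINUOUS, TIME-DEPENDENT source
# (helper; `--kind proof --supports stmt-AnomalousDissipation-27980 --as helper`)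

Summits-side helper file of route `SolenoidalFractalHomogenisation` (prover seat `ad-k1l-cellLawV-w1` g6).  Everything proved (Mathlib only); no definitions,
no named facts, no sorry.  The residual energy `Φ = ‖r‖²` of the V0 architecture (`…SidebandXResidual`) is continuous on `[0,T]`, has a RIGHT derivative
`φ(t)` at every `t ∈ [0,T)` (the reference response is only right-differentiable at the period junctions, `…SidebandResponseExt`), and obeys
`φ ≤ −σΦ + g(t)` with a continuous source `g` (defect norms; the truncation tail is only `L¹`-small in time, so the source must be time-dependent).
* **`exp_mul_le_of_deriv_right_le`** — `ContinuousOn Φ [a,b]`, `HasDerivWithinAt Φ (φ t) (Ici t) t` and `φ t ≤ −σ·Φ t + g t` on `[a,b)`, `ContinuousOn g [a,b]`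
  ⇒ `e^{σt}Φ(t) ≤ e^{σa}Φ(a) + ∫_a^t e^{σs} g(s) ds` on `[a,b]` (the product `e^{σt}Φ` against the primitive of `e^{σs}g`,
  `image_le_of_deriv_right_le_deriv_boundary` — no sign condition on `σ`, `Φ`, `g`);
* **`le_exp_of_deriv_right_le`** — the same solved for `Φ`: `Φ(t) ≤ e^{−σ(t−a)}Φ(a) + ∫_a^t e^{−σ(t−s)} g(s) ds`.
[cite: BedrossianCotiZelati2017, §2]  NOT a proof of any registered stub, of K1L_D, or of anomalous dissipation; rung F-D1.A0 infrastructure.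
-/

set_option linter.dupNamespace false

noncomputable section

namespace Summit.AnomalousDissipation.AnomalousDissipation.Theorems.SolenoidalFractalHomogenisation.LagrangianStep.RightGronwall

open Set MeasureTheory Filter Topology intervalIntegral

/-- **Forced Grönwall from the right, weighted form**: `e^{σt}Φ(t) ≤ e^{σa}Φ(a) + ∫_a^t e^{σs} g(s) ds`. [cite: BedrossianCotiZelati2017, §2] -/
theorem exp_mul_le_of_deriv_right_le {Φ φ g : ℝ → ℝ} {a b σ : ℝ}
    (hΦ : ContinuousOn Φ (Icc a b)) (hΦ' : ∀ t ∈ Ico a b, HasDerivWithinAt Φ (φ t) (Ici t) t)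
    (hg : ContinuousOn g (Icc a b)) (hineq : ∀ t ∈ Ico a b, φ t ≤ -σ * Φ t + g t) :
    ∀ t ∈ Icc a b, Real.exp (σ * t) * Φ t ≤ Real.exp (σ * a) * Φ a + ∫ s in a..t, Real.exp (σ * s) * g s := by
  intro t ht
  -- the weighted functional and the weighted source
  set Ψ : ℝ → ℝ := fun τ => Real.exp (σ * τ) * Φ τ with hΨ
  set G : ℝ → ℝ := fun τ => Real.exp (σ * τ) * g τ with hG
  have hexp : ∀ τ, HasDerivAt (fun τ => Real.exp (σ * τ)) (Real.exp (σ * τ) * σ) τ := fun τ => by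
    have h := ((hasDerivAt_id τ).const_mul σ).exp
    simpa using h
  have hexpc : Continuous fun τ => Real.exp (σ * τ) := by fun_prop
  have hΨc : ContinuousOn Ψ (Icc a b) := hexpc.continuousOn.mul hΦ
  have hGc : ContinuousOn G (Icc a b) := hexpc.continuousOn.mul hg
  have hΨ' : ∀ τ ∈ Ico a b, HasDerivWithinAt Ψ (Real.exp (σ * τ) * σ * Φ τ + Real.exp (σ * τ) * φ τ) (Ici τ) τ := fun τ hτ =>
    ((hexp τ).hasDerivWithinAt).mul (hΦ' τ hτ)
  -- the boundary function `B = Ψ a + ∫_a^· G`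
  have hGint : IntervalIntegrable G volume a b := (hGc.mono (by rw [uIcc_of_le (ht.1.trans ht.2)])).intervalIntegrable
  set B : ℝ → ℝ := fun τ => Ψ a + ∫ s in a..τ, G s with hB
  have hBc : ContinuousOn B (Icc a b) := by
    have h := continuousOn_primitive_interval' hGint (by rw [uIcc_of_le (ht.1.trans ht.2)]; exact ⟨le_rfl, ht.1.trans ht.2⟩)
    rw [uIcc_of_le (ht.1.trans ht.2)] at h
    exact continuousOn_const.add h
  have hB' : ∀ τ ∈ Ico a b, HasDerivWithinAt B (G τ) (Ici τ) τ := by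
    intro τ hτ
    have hsub : Icc τ b ⊆ Icc a b := Icc_subset_Icc_left hτ.1
    have hmemGT : Icc a b ∈ 𝓝[>] τ := Filter.mem_of_superset (Icc_mem_nhdsGT hτ.2) hsub
    have hint : IntervalIntegrable G volume a τ := hGint.mono_set (by
      rw [uIcc_of_le (ht.1.trans ht.2), uIcc_of_le hτ.1]; exact Icc_subset_Icc_right hτ.2.le)
    have hmeas : StronglyMeasurableAtFilter G (𝓝[>] τ) volume :=
      (hGc.stronglyMeasurableAtFilter_nhdsWithin measurableSet_Icc τ).filter_mono (nhdsWithin_le_iff.2 hmemGT)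
    have hcont : ContinuousWithinAt G (Ioi τ) τ := (hGc τ (Ico_subset_Icc_self hτ)).mono_of_mem_nhdsWithin hmemGT
    exact (integral_hasDerivWithinAt_right hint hmeas hcont).const_add _
  -- comparison
  have hbound : ∀ τ ∈ Ico a b, Real.exp (σ * τ) * σ * Φ τ + Real.exp (σ * τ) * φ τ ≤ G τ := by
    intro τ hτ
    have h1 := hineq τ hτ
    have h2 : Real.exp (σ * τ) * σ * Φ τ + Real.exp (σ * τ) * φ τ = Real.exp (σ * τ) * (σ * Φ τ + φ τ) := by ring
    rw [h2, hG]
    exact mul_le_mul_of_nonneg_left (by linarith) (Real.exp_pos _).le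
  have ha : Ψ a ≤ B a := by simp [hB]
  have hle := image_le_of_deriv_right_le_deriv_boundary hΨc hΨ' ha hBc hB' hbound ht
  simpa [hΨ, hB, hG] using hle

/-- **Forced Grönwall from the right**: `Φ(t) ≤ e^{−σ(t−a)}Φ(a) + ∫_a^t e^{−σ(t−s)} g(s) ds`. [cite: BedrossianCotiZelati2017, §2] -/
theorem le_exp_of_deriv_right_le {Φ φ g : ℝ → ℝ} {a b σ : ℝ}
    (hΦ : ContinuousOn Φ (Icc a b)) (hΦ' : ∀ t ∈ Ico a b, HasDerivWithinAt Φ (φ t) (Ici t) t)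
    (hg : ContinuousOn g (Icc a b)) (hineq : ∀ t ∈ Ico a b, φ t ≤ -σ * Φ t + g t) :
    ∀ t ∈ Icc a b, Φ t ≤ Real.exp (-(σ * (t - a))) * Φ a + ∫ s in a..t, Real.exp (-(σ * (t - s))) * g s := by
  intro t ht
  have h := exp_mul_le_of_deriv_right_le hΦ hΦ' hg hineq t ht
  have hpos : 0 < Real.exp (σ * t) := Real.exp_pos _
  -- divide by `e^{σt}`
  have h1 : Φ t = Real.exp (-(σ * t)) * (Real.exp (σ * t) * Φ t) := by
    rw [← mul_assoc, ← Real.exp_add, neg_add_cancel, Real.exp_zero, one_mul]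
  have h2 : Real.exp (-(σ * (t - a))) * Φ a = Real.exp (-(σ * t)) * (Real.exp (σ * a) * Φ a) := by
    rw [← mul_assoc, ← Real.exp_add]; ring_nf
  have h3 : ∫ s in a..t, Real.exp (-(σ * (t - s))) * g s = Real.exp (-(σ * t)) * ∫ s in a..t, Real.exp (σ * s) * g s := by
    rw [← intervalIntegral.integral_const_mul]
    refine intervalIntegral.integral_congr fun s _ => ?_
    show Real.exp (-(σ * (t - s))) * g s = Real.exp (-(σ * t)) * (Real.exp (σ * s) * g s)
    rw [← mul_assoc, ← Real.exp_add]; ring_nf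
  rw [h1, h2, h3, ← mul_add]
  exact mul_le_mul_of_nonneg_left h (Real.exp_pos _).le

end Summit.AnomalousDissipation.AnomalousDissipation.Theorems.SolenoidalFractalHomogenisation.LagrangianStep.RightGronwall

end
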